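import Literature.Computability.Cryptography.CsidhActionEndomorphismsProofs
import Literature.Computability.Cryptography.CsidhActionMontgomeryProofs
import Literature.NumberTheory.EllipticCurves.IsogenyDeterminantProofs
import Literature.NumberTheory.EllipticCurves.IsogenyDegreeQuadraticFormProofs
import Literature.NumberTheory.EllipticCurves.IsogenyHomProofs
import Literature.NumberTheory.EllipticCurves.IsogenyHomNsmulProofs
import Literature.NumberTheory.EllipticCurves.FrobeniusTwist
import HarnessLib

/-!
# The CSIDH class-group action: `End_p(E_A) = ℤ[π]` for a valid `A`

Sibling *proofs* file (theorems only, D-0014/D-0026) of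
`Literature.Computability.Cryptography.CsidhAction`, working towards clause (3) (freeness) of the
named fact `csidh_classGroupAction` (Castryck–Lange–Martindale–Panny–Renes, *CSIDH*,
ASIACRYPT 2018, §3 Thm. 7 and §4: "`End_p(E)` … is `ℤ[π]`" on the floor). The main theorem
`exists_int_int_apply_eq` says that for `p ≡ 3 (mod 8)` and a valid Montgomery coefficient `A`
**every `𝔽_p`-isogeny `g : E_A → E_A` acts on `E_A(𝔽̄_p)` as `m + nπ` for integers `m, n`**, and
`frob_ne_smul_on_torsion` deduces that `π` is not a scalar on `E_A[ℓ]` for any prime `ℓ ≠ p`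
(for `ℓ = 2` this is the statement that `E_A` lies on the floor, `(1 + π)/2 ∉ End_p(E_A)`).

Proof of the main theorem (elementary, no Tate modules; cf. Waterhouse 1969 Ch. 4, Delfs–Galbraith
2016 Thm. 2.1 for the statement). By Silverman, *AEC*, Cor. III.6.3 in the tree's form
(`comp_self_sub_smul_add_smul_id_eq_zero`: `f² - t f + deg f = 0` on `End_{𝔽_p}(E_A)`),
`ψ = 2g - t` satisfies `ψ² = -D`, `D = 4 deg g - t²`, and commutes with `π`; since `π² = -p`
(`frob_smul_frob_smul`), `ω = ψπ` satisfies `ω² = Dp`. An element `f` of the domain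
`End_{𝔽_p}(E_A)` with `f² = c ≥ 0` an integer is itself an integer (Cor. III.6.3 again:
`t_f f = c + deg f`, and `End` is torsion-free), so for `D > 0` we get `ω = e ∈ ℤ` with `e² = Dp`,
`p ∣ e`, and `ψπ = e = -(e/p)π²` gives `ψ = -(e/p) π`; for `D ≤ 0`, `ψ` itself is an integer.
Either way `2g = t + uπ` with `t, u ∈ ℤ`. Finally `t` and `u` are even: evaluating at the rational
point `(0, 0)` of order `2` gives `2 ∣ t + u`, and if both were odd then `π = 1` on `E_A[2]`, i.e.
every root of `x² + Ax + 1` would lie in `𝔽_p` — impossible on the floor (`no_root_of_isCoeff`,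
CSIDH Prop. 8); torsion-freeness then yields `g = t/2 + (u/2)π`.

## References

* [CastryckEtAl2018] W. Castryck, T. Lange, C. Martindale, L. Panny, J. Renes, *CSIDH*,
  ASIACRYPT 2018, §3 Thm. 7, §4, §5 Prop. 8.
* [SilvermanAEC2009] J. H. Silverman, *The Arithmetic of Elliptic Curves*, 2nd ed., Cor. III.6.3,
  Cor. III.4.11.

## Design

`noncomputable section`, `open scoped Classical`; theorems only, no definitions, no new named
facts.
-/

noncomputable section

open scoped Classical

namespace Literature.Computability.Cryptography.Csidh

open WeierstrassCurve Polynomial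

universe u

variable {p : ℕ} [Fact p.Prime]

/-! ### `End_{𝔽_p}(E_A)` is torsion-free and detects integers -/

/-- An integer killing all of `E_A(𝔽̄_p)` is zero. [folklore] -/
theorem int_eq_zero_of_forall_zsmul_eq_zero (hp8 : p % 8 = 3) {A : ZMod p} (hA : IsCoeff p A)
    {c : ℤ} (h : ∀ T : (curve p A).geomPoints, c • T = 0) : c = 0 := by
  by_contra hc
  obtain ⟨T, hT⟩ := exists_zsmul_ne_zero hp8 hA hc
  exact hT (h T)

/-- **`End_{𝔽_p}(E_A)` is torsion-free**: an element of `Hom_{𝔽_p}(E_A, E_A)` killed by a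
non-zero integer is zero (an isogeny composed with `[d]` is an isogeny, with finite kernel,
whereas `E_A(𝔽̄_p)` is infinite). [cite: SilvermanAEC2009, Prop. III.4.2(b)] -/
theorem homModule_eq_zero_of_zsmul_eq_zero (hp8 : p % 8 = 3) {A : ZMod p} (hA : IsCoeff p A)
    {f : (curve p A).geomPoints →+ (curve p A).geomPoints}
    (hf : f ∈ homModule (curve p A) (curve p A)) {d : ℤ} (hd : d ≠ 0)
    (h : ∀ T, d • f T = 0) : f = 0 := by
  haveI := isElliptic_of_isCoeff hp8 hA
  rcases (mem_homModule_iff_holds (W := curve p A) (W' := curve p A) f).1 hf with rfl | ⟨φ, rfl⟩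
  · rfl
  · exfalso
    set χ := (Isogeny.zsmul (curve p A) d hd).comp φ with hχ
    have hker : (χ.toAddMonoidHom.ker : Set (curve p A).geomPoints) = Set.univ := by
      ext T
      simp only [SetLike.mem_coe, AddMonoidHom.mem_ker, Isogeny.coe_toAddMonoidHom, Set.mem_univ,
        iff_true, hχ, Isogeny.comp_apply, Isogeny.zsmul_apply]
      exact h T
    have hfin := χ.finite_ker
    rw [hker] at hfin
    exact Set.infinite_univ (α := (curve p A).geomPoints) hfin

/-- **Silverman Cor. III.6.3 on `End_{𝔽_p}(E_A)`, pointwise**: every `f ∈ Hom_{𝔽_p}(E_A, E_A)`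
satisfies `f(fT) - t f(T) + nT = O` for integers `t` and `n = deg f ≥ 0`, with `n > 0` unless
`f = 0`. [cite: SilvermanAEC2009, Cor. III.6.3] -/
theorem exists_quadratic_relation (hp8 : p % 8 = 3) {A : ZMod p} (hA : IsCoeff p A)
    {f : (curve p A).geomPoints →+ (curve p A).geomPoints}
    (hf : f ∈ homModule (curve p A) (curve p A)) :
    ∃ t n : ℤ, 0 ≤ n ∧ (f ≠ 0 → 0 < n) ∧ ∀ T, f (f T) - t • f T + n • T = 0 := by
  haveI := isElliptic_of_isCoeff hp8 hA
  have hrel := comp_self_sub_smul_add_smul_id_eq_zero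
    (degHom_isQuadraticForm_holds (curve p A) (curve p A)) hf
  refine ⟨_, degHom (curve p A) (curve p A) f, ?_, fun hf0 ↦ degHom_pos_holds hf hf0, fun T ↦
    congrArg (fun φ : (curve p A).geomPoints →+ (curve p A).geomPoints ↦ φ T) hrel⟩
  rw [degHom]
  split_ifs
  · positivity
  · rfl

/-- **An element of `End_{𝔽_p}(E_A)` whose square is a non-negative integer is an integer**:
if `f(fT) = cT` for all `T` with `c ≥ 0`, then `f = [e]` for an integer `e` (with `e² = c`).
From Cor. III.6.3: `t f = c + deg f`; if `t = 0` then `c = deg f = 0` and `f = 0`; otherwise,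
dividing by `gcd(t, c + deg f)` (torsion-freeness), `t₁ f = M₁` with `gcd(t₁, M₁) = 1` and
`t₁² c = M₁²`, whence `t₁ = ±1`. [cite: SilvermanAEC2009, Cor. III.6.3] -/
theorem exists_eq_zsmul_of_comp_self (hp8 : p % 8 = 3) {A : ZMod p} (hA : IsCoeff p A)
    {f : (curve p A).geomPoints →+ (curve p A).geomPoints}
    (hf : f ∈ homModule (curve p A) (curve p A)) {c : ℤ} (hc : 0 ≤ c)
    (h : ∀ T, f (f T) = c • T) : ∃ e : ℤ, ∀ T, f T = e • T := by
  haveI := isElliptic_of_isCoeff hp8 hA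
  obtain ⟨t, n, hn0, hpos, hrel⟩ := exists_quadratic_relation hp8 hA hf
  -- `t f = (c + n) · 1`
  have htf : ∀ T, t • f T = (c + n) • T := fun T ↦ by
    have h1 := hrel T
    rw [h T] at h1
    linear_combination (norm := module) -h1
  by_cases ht : t = 0
  · -- then `c + n = 0`, so `c = n = 0` and `f = 0`
    have hcn : c + n = 0 :=
      int_eq_zero_of_forall_zsmul_eq_zero hp8 hA fun T ↦ by rw [← htf T, ht, zero_smul]
    by_cases hf0 : f = 0
    · exact ⟨0, fun T ↦ by rw [hf0, AddMonoidHom.zero_apply, zero_smul]⟩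
    · have := hpos hf0
      omega
  · set M := c + n with hM
    set d := Int.gcd t M with hd
    have hdpos : 0 < d := Int.gcd_pos_of_ne_zero_left M ht
    have hd0 : (d : ℤ) ≠ 0 := by exact_mod_cast hdpos.ne'
    obtain ⟨t₁, ht₁⟩ : (d : ℤ) ∣ t := Int.gcd_dvd_left ..
    obtain ⟨M₁, hM₁⟩ : (d : ℤ) ∣ M := Int.gcd_dvd_right ..
    have hcop : Int.gcd t₁ M₁ = 1 := by
      have h1 := Int.gcd_div_gcd_div_gcd hdpos
      rw [← hd] at h1
      have e1 : t / d = t₁ := by rw [ht₁, Int.mul_ediv_cancel_left _ hd0]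
      have e2 : M / d = M₁ := by rw [hM₁, Int.mul_ediv_cancel_left _ hd0]
      rwa [e1, e2] at h1
    -- `t₁ f = M₁` (cancel `d`)
    have hF : t₁ • f - M₁ • AddMonoidHom.id _ = 0 := by
      refine homModule_eq_zero_of_zsmul_eq_zero hp8 hA
        (sub_mem (Submodule.smul_mem _ _ hf) (Submodule.smul_mem _ _ (id_mem_homModule _))) hd0
        fun T ↦ ?_
      have h1 := htf T
      rw [ht₁, hM₁, mul_smul, mul_smul] at h1
      show (d : ℤ) • (t₁ • f T - M₁ • T) = 0
      rw [smul_sub, h1, sub_self]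
    have htf₁ : ∀ T, t₁ • f T = M₁ • T := fun T ↦ by
      have e : t₁ • f T - M₁ • T = 0 :=
        congrArg (fun φ : (curve p A).geomPoints →+ (curve p A).geomPoints ↦ φ T) hF
      exact sub_eq_zero.1 e
    -- `t₁² c = M₁²`
    have hsq : t₁ * t₁ * c = M₁ * M₁ := by
      rw [← sub_eq_zero]
      refine int_eq_zero_of_forall_zsmul_eq_zero hp8 hA fun T ↦ ?_
      have h1 : t₁ • (t₁ • f (f T)) = M₁ • (M₁ • T) := by
        rw [← map_zsmul f t₁ (f T), htf₁ T, map_zsmul, smul_comm t₁ M₁, htf₁ T]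
      rw [h T] at h1
      linear_combination (norm := module) h1
    -- hence `t₁ ∣ M₁`, so `t₁ = ±1`
    have hdvd : t₁ ∣ M₁ := by
      have : t₁ ∣ M₁ * M₁ := ⟨t₁ * c, by rw [← hsq]; ring⟩
      exact Int.dvd_of_dvd_mul_left_of_gcd_one this hcop
    have hab : t₁.natAbs = 1 := by
      rw [← hcop]
      exact (Nat.gcd_eq_left (Int.natAbs_dvd_natAbs.2 hdvd)).symm
    have hunit : t₁ = 1 ∨ t₁ = -1 := Int.isUnit_iff.1 (Int.isUnit_iff_natAbs_eq.2 hab)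
    have ht₁sq : t₁ * t₁ = 1 := by rcases hunit with rfl | rfl <;> norm_num
    refine ⟨t₁ * M₁, fun T ↦ ?_⟩
    rw [mul_smul, ← htf₁ T, smul_smul, ht₁sq, one_smul]

/-- `π` is not a rational scalar on `E_A(𝔽̄_p)`: `v πT = uT` for all `T` forces `v = 0`
(`π² = -p` gives `(u² + v²p) T = O`). [folklore] -/
theorem false_of_zsmul_frob_eq_zsmul (hp8 : p % 8 = 3) {A : ZMod p} (hA : IsCoeff p A) {u v : ℤ}
    (hv : v ≠ 0) (h : ∀ T : (curve p A).geomPoints, v • (frob p • T) = u • T) : False := by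
  have key : u * u + v * v * p = 0 := by
    refine int_eq_zero_of_forall_zsmul_eq_zero hp8 hA fun T ↦ ?_
    have h1 := h T
    have h2 := h (frob p • T)
    rw [frob_smul_frob_smul hp8 hA] at h2
    generalize frob p • T = X at h1 h2
    linear_combination (norm := module) (-u) • h1 - v • h2
  have hp : (0 : ℤ) < p := by exact_mod_cast (Fact.out : p.Prime).pos
  have hvv : 0 < v * v := mul_self_pos.2 hv
  have := mul_pos hvv hp
  linarith [mul_self_nonneg u]

/-! ### Two-torsion: the rational point `(0, 0)` and a non-rational one -/

omit [Fact p.Prime] in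
/-- A non-zero point `P` with `P + P = O` of a curve over any field `K` gives a non-zero,
`Γ_K`-fixed geometric point killed by `2`. [folklore] -/
theorem toGeomPoints_two_torsion {K : Type u} [Field K] (W : WeierstrassCurve K)
    (P : W.toAffine.Point) (hP : P ≠ 0) (h2 : P + P = 0) :
    W.toGeomPoints P ≠ 0 ∧ (2 : ℤ) • W.toGeomPoints P = 0 ∧
      ∀ σ : Field.absoluteGaloisGroup K, σ • W.toGeomPoints P = W.toGeomPoints P := by
  refine ⟨fun h ↦ hP (W.toGeomPoints_injective ?_), ?_, fun σ ↦ smul_toGeomPoints W σ P⟩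
  · rw [h, map_zero]
  · rw [two_smul, ← map_add, h2, map_zero]

/-- **The rational `2`-torsion point `(0, 0)` of `E_A`** as a geometric point: non-zero, killed
by `2`, fixed by Frobenius. [cite: CastryckEtAl2018, §5 (proof of Prop. 8)] -/
theorem exists_two_torsion_smul_eq (hp8 : p % 8 = 3) {A : ZMod p} (hA : IsCoeff p A) :
    ∃ T₀ : (curve p A).geomPoints, T₀ ≠ 0 ∧ (2 : ℤ) • T₀ = 0 ∧ frob p • T₀ = T₀ := by
  haveI := isElliptic_of_isCoeff hp8 hA
  have e₀ : (curve p A).toAffine.Equation 0 0 := (equation_zero_iff 0).2 (by ring)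
  have n₀ := (WeierstrassCurve.Affine.equation_iff_nonsingular (W := (curve p A).toAffine)).1 e₀
  have hne : (Affine.Point.some 0 0 n₀ : (curve p A).toAffine.Point) ≠ 0 := by rintro ⟨⟩
  obtain ⟨h1, h2, h3⟩ := toGeomPoints_two_torsion (curve p A) _ hne
    (by convert add_self_some_zero n₀)
  exact ⟨_, h1, h2, h3 _⟩

/-- **A non-rational `2`-torsion point on the floor**: for a valid `A` there is a geometric
`2`-torsion point `(r, 0)`, `r² + Ar + 1 = 0`, which is *not* fixed by Frobenius — otherwise
`r ∈ 𝔽_p` would be a rational root of `x² + Ax + 1`, contradicting `no_root_of_isCoeff`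
(CSIDH Prop. 8: `E_A[2] ⊄ E_A(𝔽_p)` on the floor). [cite: CastryckEtAl2018, §5 Prop. 8 (proof)] -/
theorem exists_two_torsion_smul_ne (hp8 : p % 8 = 3) {A : ZMod p} (hA : IsCoeff p A) :
    ∃ T₁ : (curve p A).geomPoints, (2 : ℤ) • T₁ = 0 ∧ frob p • T₁ ≠ T₁ := by
  haveI := isElliptic_of_isCoeff hp8 hA
  haveI : NeZero p := ⟨(Fact.out : p.Prime).ne_zero⟩
  set Kb := AlgebraicClosure (ZMod p)
  set A' : Kb := algebraMap (ZMod p) Kb A with hA'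
  -- a root `r` of `x² + A x + 1` in `𝔽̄_p`
  obtain ⟨r, hr⟩ : ∃ r : Kb, r ^ 2 + A' * r + 1 = 0 := by
    have hdeg : (X ^ 2 + C A' * X + 1 : Kb[X]).degree = 2 := by compute_degree!
    obtain ⟨r, hr⟩ := IsAlgClosed.exists_root (X ^ 2 + C A' * X + 1 : Kb[X])
      (by rw [hdeg]; exact two_ne_zero)
    exact ⟨r, by simpa using hr⟩
  have he : ((curve p A).baseChange Kb).toAffine.Equation r 0 := by
    rw [WeierstrassCurve.Affine.equation_iff]
    simp only [WeierstrassCurve.baseChange, WeierstrassCurve.map_a₁, WeierstrassCurve.map_a₂,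
      WeierstrassCurve.map_a₃, WeierstrassCurve.map_a₄, WeierstrassCurve.map_a₆, curve, map_zero,
      map_one]
    linear_combination (-r) * hr
  have hn := (WeierstrassCurve.Affine.equation_iff_nonsingular
    (W := ((curve p A).baseChange Kb).toAffine)).1 he
  set T₁ : (curve p A).geomPoints := Affine.Point.some r 0 hn with hT₁
  have hTT : T₁ + T₁ = 0 := Affine.Point.add_self_of_Y_eq (by
    simp [WeierstrassCurve.Affine.negY, WeierstrassCurve.baseChange, curve])
  refine ⟨T₁, by rw [two_smul, hTT], fun hfix ↦ ?_⟩
  -- `π T₁ = T₁` forces `r^p = r`, i.e. `r ∈ 𝔽_p`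
  have hx : geomPoints.xy T₁ 0 = r := by simp [hT₁]
  have key := geomPoints.toAlgEquiv_apply_xy (W := curve p A) (frob p) T₁ 0
  rw [hfix, hx] at key
  have hrp : r ^ Nat.card (ZMod p) = r := by
    rw [← frob_smul_eq_pow_card, Field.absoluteGaloisGroup.smul_def]
    exact key
  obtain ⟨r₀, hr₀⟩ := mem_range_algebraMap_of_pow_card_eq hrp
  apply no_root_of_isCoeff hp8 hA r₀
  apply (algebraMap (ZMod p) Kb).injective
  rw [map_add, map_add, map_pow, map_mul, hr₀, map_one, map_zero, ← hA', hr]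

/-! ### `End_p(E_A) = ℤ[π]` -/

/-- **Halving step.** If `2 g = t + u π` on `E_A(𝔽̄_p)` for an `𝔽_p`-isogeny `g : E_A → E_A` and
integers `t, u`, then `t, u` are even and `g = t/2 + (u/2) π`: at the rational `2`-torsion point
`(0,0)` one reads off `2 ∣ t + u`; were `t, u` odd, `π` would fix every `2`-torsion point,
contradicting `exists_two_torsion_smul_ne` (the floor); and `End` is torsion-free.
[cite: CastryckEtAl2018, §4 and §5 Prop. 8] -/
theorem exists_int_int_of_two_zsmul_eq (hp8 : p % 8 = 3) {A : ZMod p} (hA : IsCoeff p A)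
    (g : (curve p A).Isogeny (curve p A)) {t u : ℤ}
    (h : ∀ T, (2 : ℤ) • g T = t • T + u • (frob p • T)) :
    ∃ m n : ℤ, ∀ T, g T = m • T + n • (frob p • T) := by
  haveI := isElliptic_of_isCoeff hp8 hA
  -- `2 ∣ t + u`
  obtain ⟨T₀, hT₀, h2T₀, hπT₀⟩ := exists_two_torsion_smul_eq hp8 hA
  have htu : Even (t + u) := by
    by_contra hodd
    rw [Int.not_even_iff_odd] at hodd
    obtain ⟨k, hk⟩ := hodd
    apply hT₀
    have h1 := h T₀
    rw [hπT₀, ← map_zsmul, h2T₀, map_zero, ← add_smul, hk] at h1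
    -- `0 = (2k+1) T₀ = T₀`
    have : (2 * k + 1) • T₀ = k • ((2 : ℤ) • T₀) + T₀ := by module
    rw [this, h2T₀, smul_zero, zero_add] at h1
    exact h1.symm
  -- `t` (hence `u`) is even
  have ht : Even t := by
    by_contra hte
    have hue : ¬ Even u := fun hu ↦ hte ((Int.even_add.1 htu).2 hu)
    obtain ⟨a, ha⟩ := Int.not_even_iff_odd.1 hte
    obtain ⟨b, hb⟩ := Int.not_even_iff_odd.1 hue
    obtain ⟨T₁, h2T₁, hπT₁⟩ := exists_two_torsion_smul_ne hp8 hA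
    apply hπT₁
    have h1 := h T₁
    rw [← map_zsmul, h2T₁, map_zero, ha, hb] at h1
    have h2π : (2 : ℤ) • (frob p • T₁) = 0 := by rw [← frob_smul_zsmul, h2T₁, smul_zero]
    -- `0 = T₁ + π T₁`
    have e1 : ∀ Y : (curve p A).geomPoints, (2 * a + 1) • T₁ + (2 * b + 1) • Y =
        a • ((2 : ℤ) • T₁) + b • ((2 : ℤ) • Y) + (T₁ + Y) := fun Y ↦ by module
    rw [e1 (frob p • T₁), h2T₁, h2π, smul_zero, smul_zero, zero_add, zero_add] at h1
    have e2 : frob p • T₁ = -T₁ := eq_neg_of_add_eq_zero_right h1.symm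
    rw [e2, neg_eq_iff_add_eq_zero, ← two_smul ℤ, h2T₁]
  have hu : Even u := (Int.even_add.1 htu).1 ht
  obtain ⟨t', rfl⟩ := ht
  obtain ⟨u', rfl⟩ := hu
  refine ⟨t', u', fun T ↦ ?_⟩
  -- `2 (g - t' - u'π) = 0`, and `End` is torsion-free
  set πI := (curve p A).frobeniusIsogeny (σ := frob p) (fun x ↦ frob_smul_eq_pow_card x) with hπI
  have hF : g.toAddMonoidHom - (t' • AddMonoidHom.id _ + u' • πI.toAddMonoidHom) = 0 := by
    refine homModule_eq_zero_of_zsmul_eq_zero hp8 hA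
      (sub_mem (Isogeny.toAddMonoidHom_mem_homModule g) (add_mem
        (Submodule.smul_mem _ _ (id_mem_homModule _))
        (Submodule.smul_mem _ _ (Isogeny.toAddMonoidHom_mem_homModule πI)))) two_ne_zero
      fun X ↦ ?_
    show (2 : ℤ) • (g X - (t' • X + u' • πI X)) = 0
    rw [frobeniusIsogeny_apply, smul_sub, h X]
    generalize frob p • X = Y
    module
  have := congrArg (fun φ : (curve p A).geomPoints →+ (curve p A).geomPoints ↦ φ T) hF
  have e : g T - (t' • T + u' • πI T) = 0 := this
  rwa [frobeniusIsogeny_apply, sub_eq_zero] at e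

/-- **`End_p(E_A) = ℤ[π]`** (CSIDH §4, on the floor): for `p ≡ 3 (mod 8)` and a valid `A`, every
`𝔽_p`-isogeny `g : E_A → E_A` acts on `E_A(𝔽̄_p)` as `T ↦ mT + n π(T)` for integers `m, n`.
[cite: CastryckEtAl2018, §4 ("End_p(E) = ℤ[π]") with §5 Prop. 8; SilvermanAEC2009, Cor. III.6.3] -/
theorem exists_int_int_apply_eq (hp8 : p % 8 = 3) {A : ZMod p} (hA : IsCoeff p A)
    (g : (curve p A).Isogeny (curve p A)) :
    ∃ m n : ℤ, ∀ T, g T = m • T + n • (frob p • T) := by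
  haveI := isElliptic_of_isCoeff hp8 hA
  haveI : NeZero p := ⟨(Fact.out : p.Prime).ne_zero⟩
  have hgm := Isogeny.toAddMonoidHom_mem_homModule g
  obtain ⟨t, n, -, -, hg⟩ := exists_quadratic_relation hp8 hA hgm
  simp only [Isogeny.coe_toAddMonoidHom] at hg
  suffices key : ∃ t' u : ℤ, ∀ T, (2 : ℤ) • g T = t' • T + u • (frob p • T) by
    obtain ⟨t', u, hu⟩ := key
    exact exists_int_int_of_two_zsmul_eq hp8 hA g hu
  -- `ψ = 2g - t`, `ψ² = -D`
  set D : ℤ := 4 * n - t * t with hD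
  set ψ : (curve p A).geomPoints →+ (curve p A).geomPoints :=
    (2 : ℤ) • g.toAddMonoidHom - t • AddMonoidHom.id _ with hψ
  have hψm : ψ ∈ homModule (curve p A) (curve p A) :=
    sub_mem (Submodule.smul_mem _ _ hgm) (Submodule.smul_mem _ _ (id_mem_homModule _))
  have hψT : ∀ T, ψ T = (2 : ℤ) • g T - t • T := fun T ↦ rfl
  have hψψ : ∀ T, ψ (ψ T) = (-D) • T := fun T ↦ by
    have h1 := hg T
    rw [hψT, hψT, map_sub, map_zsmul, map_zsmul, hD]
    linear_combination (norm := module) (4 : ℤ) • h1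
  -- `ψ` commutes with `π`
  have hcomm : ∀ X, frob p • ψ X = ψ (frob p • X) := fun X ↦ by
    rw [hψT, hψT, smul_sub, frob_smul_zsmul, frob_smul_zsmul, ← Isogeny.map_smul]
  rcases le_or_gt D 0 with hD0 | hD0
  · -- `D ≤ 0`: `ψ² = |D| ≥ 0`, so `ψ` is an integer
    obtain ⟨e, he⟩ := exists_eq_zsmul_of_comp_self hp8 hA hψm (c := -D) (by omega) hψψ
    refine ⟨t + e, 0, fun T ↦ ?_⟩
    have h1 := he T
    rw [hψT] at h1
    rw [zero_smul, add_zero, add_smul, ← h1]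
    abel
  · -- `D > 0`: `ω = ψ π` has `ω² = D p`, so `ω = e ∈ ℤ`, `p ∣ e`, `ψ = -(e/p) π`
    set πI := (curve p A).frobeniusIsogeny (σ := frob p) (fun x ↦ frob_smul_eq_pow_card x)
      with hπI
    set ω := ψ.comp πI.toAddMonoidHom with hω
    have hωm : ω ∈ homModule (curve p A) (curve p A) :=
      comp_mem_homModule hψm (Isogeny.toAddMonoidHom_mem_homModule πI)
    have hωT : ∀ T, ω T = ψ (frob p • T) := fun T ↦ by
      show ψ (πI T) = _
      rw [frobeniusIsogeny_apply]
    have hωω : ∀ T, ω (ω T) = (D * p) • T := fun T ↦ by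
      rw [hωT, hωT, hcomm, frob_smul_frob_smul hp8 hA, hψψ]
      module
    obtain ⟨e, he⟩ := exists_eq_zsmul_of_comp_self hp8 hA hωm (c := D * p) (by positivity) hωω
    have hee : e * e = D * p := by
      rw [← sub_eq_zero]
      refine int_eq_zero_of_forall_zsmul_eq_zero hp8 hA fun T ↦ ?_
      have h1 := hωω T
      rw [he, he, smul_smul] at h1
      rw [sub_smul, h1, sub_self]
    have hpe : (p : ℤ) ∣ e := by
      have hp : Prime (p : ℤ) := Nat.prime_iff_prime_int.mp Fact.out
      rcases hp.dvd_or_dvd (show (p : ℤ) ∣ e * e from ⟨D, by rw [hee, mul_comm]⟩) with h | h <;>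
        exact h
    obtain ⟨e', rfl⟩ := hpe
    refine ⟨t, -e', fun X ↦ ?_⟩
    -- write `X = π T`
    obtain ⟨T, rfl⟩ : ∃ T, frob p • T = X := ⟨(frob p)⁻¹ • X, smul_inv_smul _ _⟩
    have h1 : ψ (frob p • T) = (p * e') • T := by rw [← hωT, he]
    rw [hψT] at h1
    have h2 := frob_smul_frob_smul hp8 hA T
    -- `2 g(πT) - t πT = p e' T = -e' π(πT)`
    generalize frob p • T = Y at h1 h2 ⊢
    rw [sub_eq_iff_eq_add'] at h1
    rw [h1, h2]
    module

/-- **`π` is not a scalar on `E_A[ℓ]`, for every prime `ℓ ≠ p`** (valid `A`): if `πT = cT` for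
all `T ∈ E_A[ℓ]`, then `π - c` kills `E_A[ℓ]` and factors as `λ ∘ [ℓ]` (*AEC* Cor. III.4.11, the
tree's `exists_eq_comp_nsmul_of_geomTorsion_le_ker_holds`) with `λ ∈ End_p(E_A) = ℤ[π]`
(`exists_int_int_apply_eq`), so `(1 - ℓn)π = ℓm + c` would be a rational scalar. For `ℓ = 2`
this says that `E_A` is on the floor: `E_A[2] ⊄ E_A(𝔽_p)`, equivalently `(1 + π)/2 ∉ End_p(E_A)`
(CSIDH Prop. 8; Delfs–Galbraith Thm. 2.7). [cite: CastryckEtAl2018, §4 and §5 Prop. 8] -/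
theorem false_of_frob_eq_smul_on_torsion (hp8 : p % 8 = 3) {A : ZMod p} (hA : IsCoeff p A)
    {ℓ : ℕ} (hℓ : ℓ.Prime) (hℓp : ℓ ≠ p) (c : ℤ)
    (h : ∀ T : (curve p A).geomPoints, (ℓ : ℤ) • T = 0 → frob p • T = c • T) : False := by
  haveI := isElliptic_of_isCoeff hp8 hA
  haveI : NeZero p := ⟨(Fact.out : p.Prime).ne_zero⟩
  -- `π - c` kills `E[ℓ]`, hence factors through `[ℓ]`
  obtain ⟨ψ, hψ⟩ := exists_isogeny_re_im hp8 hA (m := -c) (n := 1) (Or.inr one_ne_zero)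
  have hℓK : ((ℓ : ℕ) : ZMod p) ≠ 0 := fun h0 ↦
    hℓp ((Nat.prime_dvd_prime_iff_eq Fact.out hℓ).1
      ((ZMod.natCast_eq_zero_iff ℓ p).1 h0)).symm
  obtain ⟨lam, hlam⟩ := Isogeny.exists_eq_comp_nsmul_of_geomTorsion_le_ker_holds
    (W := curve p A) (W' := curve p A) hℓK ψ (fun P hP ↦ by
      rw [hψ, one_smul, h P ((Submodule.mem_torsionBy_iff _ _).1 hP), neg_smul, neg_add_cancel])
  obtain ⟨m, n, hmn⟩ := exists_int_int_apply_eq hp8 hA lam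
  refine false_of_zsmul_frob_eq_zsmul hp8 hA (u := ℓ * m + c) (v := 1 - ℓ * n) ?_ fun T ↦ ?_
  · intro h0
    have h1 : (ℓ : ℤ) ∣ 1 := ⟨n, by linarith⟩
    have h2 : (ℓ : ℤ) = 1 := Int.eq_one_of_dvd_one (by positivity) h1
    exact hℓ.one_lt.ne' (by exact_mod_cast h2)
  · have h1 := hψ T
    rw [hlam T, map_nsmul, hmn, one_smul, ← natCast_zsmul] at h1
    generalize frob p • T = Y at h1 ⊢
    linear_combination (norm := module) (-1 : ℤ) • h1

end Literature.Computability.Cryptography.Csidh
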